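/-
Copyright: the b2b-balaban T⁴-continuum CRUX team, row NE7b OWNER lineage `t4-ne7b-p1` (gen 134). Project licence.
-/
import Summits.QuantumFields.BalabanUV.T4Continuum.Spine.NE7b.SupStepKPNormLinear

/-!
# WHERE THE WEIGHT COMES BACK: BLOCKING REGENERATES THE POLYMER WEIGHT OF THE MULTI-BLOCK TERMS — the located non-closure of (356) (the step
# consumes one unit of weight, `N_{1+τ} ↦ N_τ`, and nothing on the same sites gives it back) has a purely combinatorial counterpart of the
# renormalisation-group blocking: let `B : V → W` map cells to BLOCKS (block `p'` containing the cells `blk p'`, `#blk p' ≤ b`), let the cell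
# adjacency refine the block adjacency (`R x y ⟹ B x = B y ∨ R'(B x)(B y)`), and let the blocks be `ℓ`-SEPARATED in the cell graph: every
# `R`-connected cell set meeting `k` blocks has at least `ℓ(k − 1) + 1` cells.  Re-index a family of support terms `K(Y)` by block supports,
#   `K'(Y') := Σ_{Y : B(Y) = Y'} K(Y)`   (`Σ_{Y'} K'(Y') = Σ_Y K(Y)`, block supports of connected sets `R'`-connected),
# then the pinned norm IN BLOCK UNITS with weight `τℓ` per EXTRA block is controlled by the cell norm with weight `τ`:
#   `Σ_{Y' ∋ p'}‖K'(Y')‖e^{τℓ(#Y' − 1)} ≤ Σ_{q ∈ blk p'}Σ_{Y ∋ q}‖K(Y)‖e^{τ(#Y − 1)} ≤ b·e^{−τ}·sup_q Σ_{Y∋q}‖K(Y)‖e^{τ#Y}`,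
# so the MULTI-BLOCK terms (`#Y' ≥ 2`, where `#Y' − 1 ≥ #Y'∕2`) carry weight `τℓ∕2` per block — as large as the next step wants once `ℓ ≥ 2(1+τ')∕τ` —
# while the SINGLE-BLOCK terms `K'({p'})` gain nothing: that residue is the local part the renormalisation conditions must handle.  NC-NE7b-α's
# blocking question, combinatorial half (row NE7b, node U5c; (356) + Mathlib BY NAME; [folklore])

Cell `pub-balaban`, sub-cell `t4`, spine estimate NE7b (`T4WeightBudget.RelWeightBound`; the cell's OWN estimate — NOT PRINTED in
[Bałaban 1983–89], NOT PROVED).  Crux-route work under `Spine/NE7b/` by the row OWNER (`t4-ne7b-p1` gen 134, file (359)) under FREEZE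
(0)'s crux-prover clause, on `g134/records/SCOPING-d6-iteration.md` (L2)∕DECISION (4); NOTHING of Bałaban's is named as a Lean object, valued or
asserted; no `T4Continuum/Support` leaf typed; no `def`, no notation (block supports and blocked terms are displayed `Finset.image`∕sums); zero
`sorry`.  Imports (BY NAME): the OWNER's (356) `…SupStepKPNormLinear` (only for the tree's `IsRConnected` and the lineage's sum idioms); Mathlib's
`Finset.sum_fiberwise_of_maps_to`, `Finset.sum_fiberwise_eq_sum_filter`, `Finset.card_image_le`, `Relation.ReflTransGen`.

WHY (located).  In every rigorous RG the contraction of the non-local part of the effective action comes from geometry: after blocking by a factor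
`L`, a connected polymer that meets `k ≥ 2` blocks has `≳ L(k−1)` cells, so its cell weight `e^{−τ#Y}` is worth `e^{−τL(k−1)}` in block units —
the weight per block GROWS by the factor `L`, which more than repays the unit of weight the Kotecký–Preiss step consumed ((356)).  What does not
improve is the single-block (local) part — the relevant ∕ marginal couplings — which is why renormalisation conditions exist.  This file types the
combinatorial half of that mechanism with the separation `ℓ` as an explicit hypothesis; the field rescaling and the Gaussian covariance of the next
scale are NC-NE7b-α proper and are not touched.

WHAT IS PROVED ([folklore]; `B : V → W`, `K : Finset V → ℂ`, `T` a finite family of cell polymers, `K'(Y') = Σ_{Y∈T, B(Y)=Y'}K(Y)` displayed):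
* §1 re-indexing: **`sum_blocked_eq`** (`Σ_{Y' ∈ B(T)}K'(Y') = Σ_{Y∈T}K(Y)`), `card_image_le_card` (`#B(Y) ≤ #Y`), **`isRConnected_image`** (the block
  support of an `R`-connected set is `R'`-connected when `R` refines `R'` across blocks);
* §2 THE REGENERATED NORM: `exp_blockWeight_le` (`ℓ(#B(Y) − 1) + 1 ≤ #Y ⟹ e^{τℓ(#B(Y)−1)} ≤ e^{τ(#Y−1)}`, `τ ≥ 0`), THE END
  **`blockedNorm_le_cellNorm`** (`Σ_{Y'∈B(T), p'∈Y'}‖K'(Y')‖e^{τℓ(#Y'−1)} ≤ Σ_{q∈blk p'}Σ_{Y∈T, q∈Y}‖K(Y)‖e^{τ(#Y−1)}`) and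
  **`blockedNorm_le_of_uniform`** (`≤ b·e^{−τ}·η` under `sup_q Σ_{Y∈T, q∈Y}‖K(Y)‖e^{τ#Y} ≤ η`, `0 ≤ η`, `#blk p' ≤ b`);
* §3 THE MULTI-BLOCK PART: **`multiBlockNorm_le`** (`Σ_{Y'∈B(T), p'∈Y', 2 ≤ #Y'}‖K'(Y')‖e^{(τℓ∕2)#Y'} ≤ b·e^{−τ}·η` — weight `τℓ∕2` PER BLOCK); §4 toy.

HONEST (what this is NOT).  Combinatorics of supports only: no field rescaling, no next-scale Gaussian, no estimate of the single-block (local) terms —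
their size is untouched by blocking and is the renormalisation problem (NC-NE7b-α UNRULED; (A3) scalar skeleton); the separation `ℓ` is a HYPOTHESIS on
the pair (cell graph, block map) (for cubes of side `L` in `ℤ^d` with nearest-neighbour `R` one has `ℓ ~ L`; not typed); nothing of Bałaban's asserted.
BY-NAME EFFECT ON THE WALL: NONE.  NE7b NOT PRINTED ∕ NOT PROVED; spine PROVED 0∕9; rung (B)+1 — the programme's measures remain FINITE-torus statements;
NOT the mass gap, NOT Clay.  HONEST DEPENDENCY: continuum YM on T⁴ ⇐ BetaPertH ∧ nine spine estimates (0∕9 proved); BetaPertH ⇐ (D1) ∧ (D4) ∧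
CAP+tail; G-an2-4 gates asym, D1 and NE2∕3∕4.
-/

set_option autoImplicit false

noncomputable section

namespace Summit.QuantumFields.BalabanUV.T4Continuum.NE7b.SupBlockingWeightRegeneration

open Finset Real
open scoped BigOperators
open Literature.Probability.LatticeModels

variable {V W : Type*} [DecidableEq V] [DecidableEq W] {R : V → V → Prop} {R' : W → W → Prop} {K : Finset V → ℂ} {τ η : ℝ} {ℓ b : ℕ}

/-! ## §1. Re-indexing by block supports -/

omit [DecidableEq V] in
/-- **THE POTENTIAL IS UNCHANGED BY RE-INDEXING**: `Σ_{Y' ∈ B(T)} Σ_{Y∈T, B(Y)=Y'} K(Y) = Σ_{Y∈T} K(Y)`. [folklore] -/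
theorem sum_blocked_eq (B : V → W) (K : Finset V → ℂ) (T : Finset (Finset V)) :
    ∑ Y' ∈ T.image (fun Y => Y.image B), ∑ Y ∈ T with Y.image B = Y', K Y = ∑ Y ∈ T, K Y :=
  sum_fiberwise_of_maps_to (fun _ hY => mem_image_of_mem _ hY) _

omit [DecidableEq V] in
/-- A block support has at most as many blocks as the polymer has cells. [folklore] -/
theorem card_image_le_card (B : V → W) (Y : Finset V) : (Y.image B).card ≤ Y.card := card_image_le

omit [DecidableEq V] in
/-- **THE BLOCK SUPPORT OF A CONNECTED POLYMER IS CONNECTED**: if the cell adjacency refines the block adjacency across blocks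
(`R x y ⟹ B x = B y ∨ R'(B x)(B y)`), the image of an `R`-connected cell set is `R'`-connected. [folklore] -/
theorem isRConnected_image (B : V → W) (hBR : ∀ x y, R x y → B x = B y ∨ R' (B x) (B y)) {Y : Finset V} (hY : IsRConnected R Y) :
    IsRConnected R' (Y.image B) := by
  refine ⟨hY.1.image _, fun v' hv' w' hw' => ?_⟩
  obtain ⟨v, hv, rfl⟩ := mem_image.1 hv'
  obtain ⟨w, hw, rfl⟩ := mem_image.1 hw'
  have key : ∀ u, Relation.ReflTransGen (fun x y => R x y ∧ x ∈ Y ∧ y ∈ Y) v u →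
      Relation.ReflTransGen (fun x y => R' x y ∧ x ∈ Y.image B ∧ y ∈ Y.image B) (B v) (B u) := by
    intro u hu
    induction hu with
    | refl => exact Relation.ReflTransGen.refl
    | tail _ hst ih =>
        obtain ⟨hr, hb, hc⟩ := hst
        rcases hBR _ _ hr with heq | hr'
        · rw [← heq]; exact ih
        · exact ih.tail ⟨hr', mem_image_of_mem B hb, mem_image_of_mem B hc⟩
  exact key w (hY.2 v hv w hw)

/-! ## §2. The regenerated norm -/

omit [DecidableEq V] in
/-- **Separation converts cell weight into block weight**: `0 ≤ τ`, `ℓ(#B(Y) − 1) + 1 ≤ #Y` ⟹ `e^{τℓ(#B(Y) − 1)} ≤ e^{τ(#Y − 1)}` (naturals, truncated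
subtraction; cast to `ℝ`). [folklore] -/
theorem exp_blockWeight_le (hτ : 0 ≤ τ) (B : V → W) {Y : Finset V} (hsep : ℓ * ((Y.image B).card - 1) + 1 ≤ Y.card) :
    Real.exp (τ * ((ℓ * ((Y.image B).card - 1) : ℕ) : ℝ)) ≤ Real.exp (τ * (((Y.card - 1 : ℕ)) : ℝ)) := by
  refine exp_le_exp.2 (mul_le_mul_of_nonneg_left ?_ hτ)
  have h : ℓ * ((Y.image B).card - 1) ≤ Y.card - 1 := by omega
  exact_mod_cast h

/-- **THE END — THE BLOCKED NORM IS CONTROLLED BY THE CELL NORM, WITH WEIGHT `τℓ` PER EXTRA BLOCK.**  `0 ≤ τ`; every cell lies in the cell list of its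
block (`q ∈ blk (B q)`); the blocks are `ℓ`-separated on the polymers of `T` (`ℓ(#B(Y) − 1) + 1 ≤ #Y` for `Y ∈ T`) ⟹ for every block `p'`,
`Σ_{Y'∈B(T), p'∈Y'}‖K'(Y')‖e^{τℓ(#Y'−1)} ≤ Σ_{q∈blk p'}Σ_{Y∈T, q∈Y}‖K(Y)‖e^{τ(#Y−1)}`. [folklore] -/
theorem blockedNorm_le_cellNorm (hτ : 0 ≤ τ) (B : V → W) (blk : W → Finset V) (hblk : ∀ q, q ∈ blk (B q)) (T : Finset (Finset V))
    (hsep : ∀ Y ∈ T, ℓ * ((Y.image B).card - 1) + 1 ≤ Y.card) (p' : W) :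
    ∑ Y' ∈ T.image (fun Y => Y.image B) with p' ∈ Y',
        ‖∑ Y ∈ T with Y.image B = Y', K Y‖ * Real.exp (τ * ((ℓ * (Y'.card - 1) : ℕ) : ℝ)) ≤
      ∑ q ∈ blk p', ∑ Y ∈ T with q ∈ Y, ‖K Y‖ * Real.exp (τ * ((Y.card - 1 : ℕ) : ℝ)) := by
  classical
  set g : Finset V → ℝ := fun Y => ‖K Y‖ * Real.exp (τ * ((Y.card - 1 : ℕ) : ℝ)) with hg
  have hg0 : ∀ Y, 0 ≤ g Y := fun Y => by positivity
  calc ∑ Y' ∈ T.image (fun Y => Y.image B) with p' ∈ Y', ‖∑ Y ∈ T with Y.image B = Y', K Y‖ * Real.exp (τ * ((ℓ * (Y'.card - 1) : ℕ) : ℝ))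
      ≤ ∑ Y' ∈ T.image (fun Y => Y.image B) with p' ∈ Y', ∑ Y ∈ T with Y.image B = Y', g Y := by
        refine sum_le_sum fun Y' _ => ?_
        calc ‖∑ Y ∈ T with Y.image B = Y', K Y‖ * Real.exp (τ * ((ℓ * (Y'.card - 1) : ℕ) : ℝ))
            ≤ (∑ Y ∈ T with Y.image B = Y', ‖K Y‖) * Real.exp (τ * ((ℓ * (Y'.card - 1) : ℕ) : ℝ)) :=
              mul_le_mul_of_nonneg_right (norm_sum_le _ _) (exp_pos _).le
          _ = ∑ Y ∈ T with Y.image B = Y', ‖K Y‖ * Real.exp (τ * ((ℓ * (Y'.card - 1) : ℕ) : ℝ)) := sum_mul _ _ _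
          _ ≤ ∑ Y ∈ T with Y.image B = Y', g Y := by
              refine sum_le_sum fun Y hY => mul_le_mul_of_nonneg_left ?_ (norm_nonneg _)
              obtain ⟨hYT, hU⟩ := mem_filter.1 hY
              rw [← hU]
              exact exp_blockWeight_le hτ B (hsep Y hYT)
    _ = ∑ Y ∈ T with Y.image B ∈ (T.image (fun Y => Y.image B)).filter (fun Y' => p' ∈ Y'), g Y := sum_fiberwise_eq_sum_filter _ _ _ _
    _ ≤ ∑ Y ∈ T with ∃ q ∈ blk p', q ∈ Y, g Y := by
        refine sum_le_sum_of_subset_of_nonneg (fun Y hY => ?_) fun _ _ _ => hg0 _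
        obtain ⟨hYT, hY'⟩ := mem_filter.1 hY
        obtain ⟨q, hqY, hq⟩ := mem_image.1 (mem_filter.1 hY').2
        exact mem_filter.2 ⟨hYT, q, hq ▸ hblk q, hqY⟩
    _ ≤ ∑ Y ∈ T with ∃ q ∈ blk p', q ∈ Y, ∑ q ∈ blk p' with q ∈ Y, g Y := by
        refine sum_le_sum fun Y hY => ?_
        obtain ⟨q, hqb, hqY⟩ := (mem_filter.1 hY).2
        have hmem : q ∈ (blk p').filter fun q => q ∈ Y := mem_filter.2 ⟨hqb, hqY⟩
        calc g Y = ∑ q' ∈ ({q} : Finset V), g Y := by simp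
          _ ≤ _ := sum_le_sum_of_subset_of_nonneg (by simpa using hmem) fun _ _ _ => hg0 _
    _ ≤ ∑ Y ∈ T, ∑ q ∈ blk p' with q ∈ Y, g Y := sum_le_sum_of_subset_of_nonneg (filter_subset _ _) fun _ _ _ => sum_nonneg fun _ _ => hg0 _
    _ = ∑ q ∈ blk p', ∑ Y ∈ T with q ∈ Y, g Y := by
        rw [sum_comm' (t' := blk p') (s' := fun q => T.filter fun Y => q ∈ Y)]
        intro Y q
        simp only [mem_filter]
        tauto

/-- **THE BLOCKED NORM FROM A UNIFORM CELL NORM**: in addition `#blk p' ≤ b` and `sup_q Σ_{Y∈T, q∈Y}‖K(Y)‖e^{τ#Y} ≤ η` ⟹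
`Σ_{Y'∈B(T), p'∈Y'}‖K'(Y')‖e^{τℓ(#Y'−1)} ≤ b·e^{−τ}·η` (a polymer through `q` has `#Y ≥ 1`, so `e^{τ(#Y−1)} = e^{−τ}e^{τ#Y}`). [folklore] -/
theorem blockedNorm_le_of_uniform (hτ : 0 ≤ τ) (B : V → W) (blk : W → Finset V) (hblk : ∀ q, q ∈ blk (B q)) (hb : ∀ p', (blk p').card ≤ b)
    (T : Finset (Finset V)) (hsep : ∀ Y ∈ T, ℓ * ((Y.image B).card - 1) + 1 ≤ Y.card)
    (hN : ∀ q : V, ∑ Y ∈ T with q ∈ Y, ‖K Y‖ * Real.exp (τ * (Y.card : ℝ)) ≤ η) (hη0 : 0 ≤ η) (p' : W) :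
    ∑ Y' ∈ T.image (fun Y => Y.image B) with p' ∈ Y',
        ‖∑ Y ∈ T with Y.image B = Y', K Y‖ * Real.exp (τ * ((ℓ * (Y'.card - 1) : ℕ) : ℝ)) ≤ b * (Real.exp (-τ) * η) := by
  refine (blockedNorm_le_cellNorm hτ B blk hblk T hsep p').trans ?_
  -- each inner sum: shift the weight by one cell
  have hinner : ∀ q, ∑ Y ∈ T with q ∈ Y, ‖K Y‖ * Real.exp (τ * ((Y.card - 1 : ℕ) : ℝ)) ≤ Real.exp (-τ) * η := by
    intro q
    have hterm : ∀ Y ∈ T.filter (fun Y => q ∈ Y),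
        ‖K Y‖ * Real.exp (τ * ((Y.card - 1 : ℕ) : ℝ)) = Real.exp (-τ) * (‖K Y‖ * Real.exp (τ * (Y.card : ℝ))) := by
      intro Y hY
      have h1 : 1 ≤ Y.card := card_pos.2 ⟨q, (mem_filter.1 hY).2⟩
      have hc : (((Y.card - 1 : ℕ)) : ℝ) = (Y.card : ℝ) - 1 := by rw [Nat.cast_sub h1, Nat.cast_one]
      rw [hc, show τ * ((Y.card : ℝ) - 1) = -τ + τ * (Y.card : ℝ) by ring, Real.exp_add]
      ring
    rw [sum_congr rfl hterm, ← mul_sum]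
    exact mul_le_mul_of_nonneg_left (hN q) (exp_pos _).le
  calc ∑ q ∈ blk p', ∑ Y ∈ T with q ∈ Y, ‖K Y‖ * Real.exp (τ * ((Y.card - 1 : ℕ) : ℝ))
      ≤ ∑ _q ∈ blk p', Real.exp (-τ) * η := sum_le_sum fun q _ => hinner q
    _ = (blk p').card * (Real.exp (-τ) * η) := by rw [sum_const, nsmul_eq_mul]
    _ ≤ b * (Real.exp (-τ) * η) := mul_le_mul_of_nonneg_right (by exact_mod_cast hb p') (by positivity)

/-! ## §3. The multi-block part carries weight `τℓ∕2` per block -/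

/-- **THE MULTI-BLOCK TERMS HAVE WEIGHT `τℓ∕2` PER BLOCK**: under the hypotheses of `blockedNorm_le_of_uniform`,
`Σ_{Y'∈B(T), p'∈Y', 2 ≤ #Y'}‖K'(Y')‖e^{(τℓ∕2)#Y'} ≤ b·e^{−τ}·η` (`#Y' ≥ 2 ⟹ #Y'∕2 ≤ #Y' − 1`) — in block units the non-local part of the output
re-enters the next step with weight `τℓ∕2 ≥ 1 + τ'` as soon as `ℓ ≥ 2(1+τ')∕τ`; the single-block terms are not improved. [folklore] -/
theorem multiBlockNorm_le (hτ : 0 ≤ τ) (B : V → W) (blk : W → Finset V) (hblk : ∀ q, q ∈ blk (B q)) (hb : ∀ p', (blk p').card ≤ b)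
    (T : Finset (Finset V)) (hsep : ∀ Y ∈ T, ℓ * ((Y.image B).card - 1) + 1 ≤ Y.card)
    (hN : ∀ q : V, ∑ Y ∈ T with q ∈ Y, ‖K Y‖ * Real.exp (τ * (Y.card : ℝ)) ≤ η) (hη0 : 0 ≤ η) (p' : W) :
    ∑ Y' ∈ T.image (fun Y => Y.image B) with p' ∈ Y' ∧ 2 ≤ Y'.card,
        ‖∑ Y ∈ T with Y.image B = Y', K Y‖ * Real.exp (τ * ℓ / 2 * (Y'.card : ℝ)) ≤ b * (Real.exp (-τ) * η) := by
  refine le_trans ?_ (blockedNorm_le_of_uniform hτ B blk hblk hb T hsep hN hη0 p')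
  calc ∑ Y' ∈ T.image (fun Y => Y.image B) with p' ∈ Y' ∧ 2 ≤ Y'.card,
        ‖∑ Y ∈ T with Y.image B = Y', K Y‖ * Real.exp (τ * ℓ / 2 * (Y'.card : ℝ))
      ≤ ∑ Y' ∈ T.image (fun Y => Y.image B) with p' ∈ Y' ∧ 2 ≤ Y'.card,
        ‖∑ Y ∈ T with Y.image B = Y', K Y‖ * Real.exp (τ * ((ℓ * (Y'.card - 1) : ℕ) : ℝ)) := by
        refine sum_le_sum fun Y' hY' => mul_le_mul_of_nonneg_left (exp_le_exp.2 ?_) (norm_nonneg _)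
        obtain ⟨-, -, h2⟩ := mem_filter.1 hY'
        have hcast : (((ℓ * (Y'.card - 1) : ℕ)) : ℝ) = (ℓ : ℝ) * ((Y'.card : ℝ) - 1) := by
          rw [Nat.cast_mul, Nat.cast_sub (by omega), Nat.cast_one]
        rw [hcast]
        have h2' : (2 : ℝ) ≤ (Y'.card : ℝ) := by exact_mod_cast h2
        have hℓ : (0 : ℝ) ≤ ℓ := Nat.cast_nonneg ℓ
        nlinarith [mul_nonneg hτ hℓ]
    _ ≤ ∑ Y' ∈ T.image (fun Y => Y.image B) with p' ∈ Y',
        ‖∑ Y ∈ T with Y.image B = Y', K Y‖ * Real.exp (τ * ((ℓ * (Y'.card - 1) : ℕ) : ℝ)) :=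
        sum_le_sum_of_subset_of_nonneg (fun Y' hY' => mem_filter.2 ⟨(mem_filter.1 hY').1, (mem_filter.1 hY').2.1⟩) fun _ _ _ => by positivity

/-! ## §4. Toy -/

omit [DecidableEq V] in
/-- Toy (§1): blocking everything into ONE block (`W = Unit`): the block support of any nonempty polymer is `{()}`, of cardinality `≤ #Y`. -/
example (Y : Finset (Fin 3)) : (Y.image fun _ => ()).card ≤ Y.card := card_image_le_card (fun _ => ()) Y

end Summit.QuantumFields.BalabanUV.T4Continuum.NE7b.SupBlockingWeightRegeneration
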